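import Summits.QuantumAdvantage.AdviceFreeQNC0.WalkTube
import Summits.QuantumAdvantage.AdviceFreeQNC0.HammingLayerSums
import HarnessLib

/-!
# Cell qa-qnc0 (rung F-Q1, route `RingFrame`, crux α `RingToElim`): THE TUBE BOUND — T11-5
# `BinomTailLower`, the binomial lower tail at `C√m` below the middle (qn-p2 ROUND-11, ask P11-C)

Planner qa-qnc0-p2's ROUND-11 §1 T11-5 (statement `BinomTailLower` in `WalkTube.lean`).  PROVED:
**`binomTailLower : BinomTailLower`** with `c = e^{−8(C+1)²}/4`, `m₀ = 64(C+1)²`: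
`N_{⌊m/2⌋ − t}(m) = Σ_{j ≤ m/2 − t} C(m, j) ≥ c·2^m` for all `t ≤ C⌊√m⌋`, `m ≥ m₀`.

Proof over the cell's `HammingLayerSums.lean`: the central window `{j : (2j − m)² < 4m}`
(`BinomTail.window`) carries `≥ (3/4)·2^m` by the Chebyshev tail `sum_choose_filter_le_div`
(`window_mass`) and has `≤ 2⌊√m⌋ + 3` layers (`card_window_le`); every layer `k` within
`s = t + ⌊√m⌋` of the middle satisfies `C(m, j) ≤ e^{8s²/m}·C(m, k)` for all `j`
(`choose_le_exp_mul_choose`, needs `8s ≤ m`), so each of the `⌊√m⌋ + 1` layers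
`k ∈ [m/2 − t − ⌊√m⌋, m/2 − t]` has `C(m,k) ≥ 2^m/(4(⌊√m⌋+1)e^{8s²/m})`, and their sum is
`≥ e^{−8s²/m}·2^m/4 ≥ e^{−8(C+1)²}·2^m/4`.

Elementary ([folklore]).  WHAT THIS IS NOT: nothing on α by itself (the plan is
`WalkTubeRank.tubePlan`); separation NOT moved by this file alone.
-/

noncomputable section

open Classical

namespace Summit.QuantumAdvantage.AdviceFreeQNC0

open Finset
open Literature.Computability.MetaComplexity Literature.Computability.MetaComplexity.Smolensky

namespace BinomTail

/-- the central window of layers: `j ≤ m` with `(2j − m)² < 4m`. -/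
def window (m : ℕ) : Finset ℕ :=
  (range (m + 1)).filter fun j => ¬ ((4 * m : ℝ) ≤ (2 * (j : ℝ) - m) ^ 2)

/-- **The central window carries three quarters of the cube** (Chebyshev). -/
theorem window_mass {m : ℕ} (hm : 0 < m) :
    (3 / 4 : ℝ) * (2 : ℝ) ^ m ≤ ∑ j ∈ window m, (m.choose j : ℝ) := by
  have htot : ∑ j ∈ range (m + 1), (m.choose j : ℝ) = (2 : ℝ) ^ m := sum_range_choose_real m
  have hmR : (0 : ℝ) < m := by exact_mod_cast hm
  have htail := sum_choose_filter_le_div m (T := 4 * m) (by positivity)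
  have hsplit := Finset.sum_filter_add_sum_filter_not (range (m + 1))
    (fun j => (4 * m : ℝ) ≤ (2 * (j : ℝ) - m) ^ 2) (fun j => (m.choose j : ℝ))
  have e : (m : ℝ) * (2 : ℝ) ^ m / (4 * m) = (2 : ℝ) ^ m / 4 := by
    field_simp
  rw [e] at htail
  unfold window
  linarith

/-- The window sits within `⌊√m⌋ + 1` of the middle. -/
theorem window_subset (m : ℕ) :
    window m ⊆ Icc (m / 2 - Nat.sqrt m - 1) (m / 2 + Nat.sqrt m + 1) := by
  intro j hj
  unfold window at hj
  rw [mem_filter, mem_range] at hj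
  obtain ⟨hjm, hj⟩ := hj
  rw [not_le] at hj
  set r := Nat.sqrt m with hr
  have hm_lt : m < (r + 1) * (r + 1) := Nat.lt_succ_sqrt m
  have h1 : ((2 * (j : ℤ) - m : ℤ) : ℝ) ^ 2 < ((2 * r + 2 : ℤ) : ℝ) ^ 2 := by
    push_cast
    have : (4 * m : ℝ) < (2 * r + 2 : ℝ) ^ 2 := by
      have h' : (m : ℝ) < ((r + 1) * (r + 1) : ℕ) := by exact_mod_cast hm_lt
      push_cast at h'
      nlinarith
    linarith
  have h2 : (2 * (j : ℤ) - m) ^ 2 < (2 * r + 2 : ℤ) ^ 2 := by exact_mod_cast h1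
  have h3 := abs_lt_of_sq_lt_sq h2 (by positivity)
  rw [abs_lt] at h3
  rw [mem_Icc]
  omega

/-- Hence the window has at most `2⌊√m⌋ + 3` layers. -/
theorem card_window_le (m : ℕ) : (window m).card ≤ 2 * Nat.sqrt m + 3 := by
  refine le_trans (card_le_card (window_subset m)) ?_
  rw [Nat.card_Icc]
  omega

end BinomTail

open BinomTail in
/-- **T11-5 `BinomTailLower` — PROVED** (`c = e^{−8(C+1)²}/4`, `m₀ = 64(C+1)²`): the binomial lower
tail at `t ≤ C⌊√m⌋` below the middle has constant mass.  Proof: the central window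
`{(2j−m)² < 4m}` carries `≥ (3/4)·2^m` (Chebyshev, `sum_choose_filter_le_div`) on `≤ 2⌊√m⌋+3`
layers, and every layer within `s = t + ⌊√m⌋` of the middle is at least `e^{−8s²/m}` times any
layer (`choose_le_exp_mul_choose`); the `⌊√m⌋ + 1` layers `m/2 − t − ⌊√m⌋ … m/2 − t` then carry
`≥ e^{−8s²/m}·2^m/4 ≥ c·2^m`. -/
theorem binomTailLower : BinomTailLower := by
  intro C
  refine ⟨Real.exp (-(8 * ((C : ℝ) + 1) ^ 2)) / 4, by positivity, 64 * (C + 1) ^ 2,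
    fun m hm t ht => ?_⟩
  set r := Nat.sqrt m with hr
  have hr8 : 8 * (C + 1) ≤ r := by
    rw [hr, Nat.le_sqrt]
    nlinarith
  have hrr : r * r ≤ m := Nat.sqrt_le m
  have hm_lt : m < (r + 1) * (r + 1) := Nat.lt_succ_sqrt m
  have hm0 : 0 < m := by nlinarith
  set s := t + r with hs
  have hsr : s ≤ (C + 1) * r := by rw [hs]; nlinarith
  have h8s : 8 * s ≤ m := by nlinarith
  have htr : t + r ≤ m / 2 := by
    have : 8 * (t + r) ≤ m := h8s
    omega
  -- the lower block of layers `K = [m/2 − t − r, m/2 − t]`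
  set K := Icc (m / 2 - t - r) (m / 2 - t) with hK
  have hKcard : K.card = r + 1 := by rw [hK, Nat.card_Icc]; omega
  have hKsub : K ⊆ range (m / 2 - t + 1) := by
    intro k hk
    rw [hK, mem_Icc] at hk
    rw [mem_range]
    omega
  -- each layer of `K` is large
  set E := Real.exp (8 * (s : ℝ) ^ 2 / m) with hE
  have hEpos : 0 < E := Real.exp_pos _
  have hW := window_mass hm0
  have hWcard := card_window_le m
  have hlayer : ∀ k ∈ K, (2 : ℝ) ^ m / 4 ≤ (r + 1 : ℝ) * (E * (m.choose k : ℝ)) := by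
    intro k hk
    rw [hK, mem_Icc] at hk
    have hk1 : m / 2 ≤ k + s := by omega
    have hk2 : k ≤ m - m / 2 + s := by omega
    have hall : ∀ j ∈ window m, (m.choose j : ℝ) ≤ E * m.choose k :=
      fun j _ => choose_le_exp_mul_choose h8s hk1 hk2 j
    have hsum : ∑ j ∈ window m, (m.choose j : ℝ) ≤ (window m).card * (E * m.choose k) := by
      calc ∑ j ∈ window m, (m.choose j : ℝ) ≤ ∑ _j ∈ window m, E * (m.choose k : ℝ) :=
            sum_le_sum hall
        _ = (window m).card * (E * m.choose k) := by rw [sum_const, nsmul_eq_mul]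
    have hWc : ((window m).card : ℝ) ≤ 3 * (r + 1) := by
      have : ((window m).card : ℝ) ≤ (2 * r + 3 : ℕ) := by exact_mod_cast hWcard
      push_cast at this
      linarith
    have hEk : 0 ≤ E * (m.choose k : ℝ) := by positivity
    nlinarith
  -- sum over `K`
  have hKsum : (r + 1 : ℝ) * ((2 : ℝ) ^ m / 4) ≤ (r + 1 : ℝ) * (E * ∑ k ∈ K, (m.choose k : ℝ)) := by
    rw [mul_sum, mul_sum]
    calc (r + 1 : ℝ) * ((2 : ℝ) ^ m / 4) = ∑ _k ∈ K, (2 : ℝ) ^ m / 4 := by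
          rw [sum_const, hKcard, nsmul_eq_mul]; push_cast; ring
      _ ≤ ∑ k ∈ K, (r + 1 : ℝ) * (E * (m.choose k : ℝ)) := sum_le_sum hlayer
  have hr1 : (0 : ℝ) < r + 1 := by positivity
  have hKsum' : (2 : ℝ) ^ m / 4 ≤ E * ∑ k ∈ K, (m.choose k : ℝ) := le_of_mul_le_mul_left hKsum hr1
  -- `N_{m/2 − t} ≥ Σ_K`
  have hN : ∑ k ∈ K, (m.choose k : ℝ) ≤ (numMonomials m (m / 2 - t) : ℝ) := by
    unfold numMonomials
    push_cast
    exact sum_le_sum_of_subset_of_nonneg hKsub fun j _ _ => Nat.cast_nonneg _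
  -- `e^{−8s²/m} ≥ e^{−8(C+1)²}`
  have hexp : Real.exp (-(8 * ((C : ℝ) + 1) ^ 2)) ≤ E⁻¹ := by
    rw [hE, ← Real.exp_neg]
    apply Real.exp_le_exp.2
    have hmR : (0 : ℝ) < m := by exact_mod_cast hm0
    rw [neg_le_neg_iff, div_le_iff₀ hmR]
    have h1 : (s : ℝ) ≤ ((C : ℝ) + 1) * r := by exact_mod_cast hsr
    have h2 : ((r : ℝ)) * r ≤ m := by exact_mod_cast hrr
    have h3 : (0 : ℝ) ≤ s := Nat.cast_nonneg _
    have h4 : (s : ℝ) ^ 2 ≤ (((C : ℝ) + 1) * r) ^ 2 := pow_le_pow_left₀ h3 h1 2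
    nlinarith
  -- conclude
  have hfinal : Real.exp (-(8 * ((C : ℝ) + 1) ^ 2)) / 4 * (2 : ℝ) ^ m ≤
      ∑ k ∈ K, (m.choose k : ℝ) := by
    have h1 : E⁻¹ * ((2 : ℝ) ^ m / 4) ≤ ∑ k ∈ K, (m.choose k : ℝ) := by
      rw [inv_mul_le_iff₀ hEpos]
      exact hKsum'
    have h2 : (0 : ℝ) ≤ (2 : ℝ) ^ m / 4 := by positivity
    calc Real.exp (-(8 * ((C : ℝ) + 1) ^ 2)) / 4 * (2 : ℝ) ^ m
        = Real.exp (-(8 * ((C : ℝ) + 1) ^ 2)) * ((2 : ℝ) ^ m / 4) := by ring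
      _ ≤ E⁻¹ * ((2 : ℝ) ^ m / 4) := mul_le_mul_of_nonneg_right hexp h2
      _ ≤ _ := h1
  exact le_trans hfinal hN

end Summit.QuantumAdvantage.AdviceFreeQNC0

end
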